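/-
Copyright (c) 2026 the pub-hodgecm-mathlib formalisation cell (harness21).  Prover seat hodgecm-mathlib-K2E3-p17 (g7), Track B «K2-LIT» ∕ h413
(`stmt-HodgeConjecture-24833`), line `K2_E3_EllipticInputs`, unit U12 §L, road «GL-[M6]-sc» (owner K2E3-p23 (g5)), MEMO «M6sc-BLUEPRINT v4» §2 brick T15-log,
steps (b)+(c) READ AT THE ROAD'S QUOTIENT `G' = GL₃(F) ⧸ ϖ^ℤ·1`: «a weight `W` on `G'` dominated upstairs by a function locally integrable on the invertible
matrices is locally integrable for every Haar measure of `G'`».  2026-09-04.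
-/
import Summits.HodgeConjecture.HodgeConjecture.Theorems.K2E3HaarLocallyIntegrableTransport   -- ★ p858266 (this seat): (b) `locallyIntegrable_comp_coe`, (c) `locallyIntegrable_of_locallyIntegrable_comp`
import Summits.HodgeConjecture.HodgeConjecture.Theorems.K2E3GL3SupercuspidalCharLocInt        -- ★ B6-final p857950: `eq_one_of_mem_glInt_of_mk_eq_one` (`GL₃(𝒪) ∩ ϖ^ℤ·1 = 1`); brings ★ `K2E3GL3ModCentre` frame helpers
import HarnessLib

/-!
# K2_E3 road (h413), §L — brick T15-log at `G' = GL₃(F) ⧸ ϖ^ℤ·1`: local integrability of a weight on `G'` from a dominating function on `{X ∈ M₃(F) | IsUnit X}`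

Cell `pub/hodgecm-mathlib` (D-0151), Track B, seat K2E3-p17 (g7); MEMO «M6sc-BLUEPRINT v4» (K2E3-p23 (g5)) §1 `(hW) LocallyIntegrable W μ` at `G'` and §2 «T15-log (b),
(c): push to `G'` by ★ B0b (`π` is injective on `gK`, `K ∩ ϖ^ℤ = 1`)».  This file specialises ★ `K2E3HaarLocallyIntegrableTransport` to the road's quotient map
`mk : GL₃(F) → G'` (continuous, open, surjective; injective on `GL₃(𝒪)` by ★ B6-final `eq_one_of_mem_glInt_of_mk_eq_one`).  `--supports stmt-HodgeConjecture-24833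
--as helper`; THEOREMS ONLY (no definition ∕ instance ∕ notation ∕ named fact ∕ `sorry`); never imports `Cruxes/…/Lines`.  COUNT-NEUTRAL.

* §0 `locallyIntegrableOn_continuousOn_mul` ∕ `…_mul_continuousOn` — generic: `LocallyIntegrableOn f s μ`, `g` continuous on the open `s` ⟹ `g·f`, `f·g`
  locally integrable on `s` (for the `‖det X‖`-factors, continuous on `{IsUnit}`, in `|D♮(X)| = ‖disc χ_X‖·‖det X‖⁻²`).
* §1 **`locallyIntegrable_of_locallyIntegrable_comp_mk`** — `W : G' → E` a.e.-strongly measurable for a Haar measure `μ'` of `G'`, `W ∘ mk` locally integrable for a Haar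
  measure `ρ` of `GL₃(F)` ⟹ `W` locally `μ'`-integrable.
* §2 **`locallyIntegrable_of_norm_comp_mk_le`** — if moreover `‖W (mk g)‖ ≤ w(↑g)` for all `g ∈ GL₃(F)` with `w` locally `dX`-integrable ON `{X | IsUnit X} ⊆ M₃(F)`
  (`dX` additive Haar), then `W` is locally `μ'`-integrable — the shape in which the ASM of `sig_K2E3GL3ModUniformizerNonEllEstimates` consumes T15:
  `w = C·1_{non-ell reg}·‖disc χ‖^{-1/2}(1+|log ‖disc χ‖|)^κ ×` (continuous factors of `‖det‖`), locally integrable by ★ T15-split ∕ T15-mixed on the Lie algebra.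
[HarishChandra1970, Part I §1, Part V §6 Thm. 15, Part VII §3] [WeilBNT1967, Ch. II §5]
HONEST LABEL: HC_CM is proved only modulo the 7 printed citations (2 remaining named inputs: hLiu418 = stmt-HodgeConjecture-24832, h413 = stmt-HodgeConjecture-24833)
until rung 0 closes; count-neutral helper.

## Mathlib ∕ tree search
Tree: ★ `K2E3HaarLocallyIntegrableTransport.{locallyIntegrable_of_locallyIntegrable_comp, locallyIntegrable_comp_coe}`, ★ B6-final `eq_one_of_mem_glInt_of_mk_eq_one`,
★ `K2E3GL3ModCentre.{secondCountableTopology_gl3, locallyCompactSpace_gl3}`, ★ `isOpen_glInt`.  Mathlib: `QuotientGroup.continuous_mk`, `QuotientGroup.isOpenMap_coe`,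
`QuotientGroup.mk_surjective`, `QuotientGroup.instLocallyCompactSpace`, `QuotientGroup.instSecondCountableTopology`, `LocallyIntegrable.mono`.
Dedup: `rg "locallyIntegrable.*comp_mk|comp_mk_le|locallyIntegrableOn_continuousOn_mul"` over Literature∕Summits∕Mathlib — no hits (Mathlib has only the `IntegrableOn` forms).

## References
* [HarishChandra1970] Harish-Chandra (van Dijk), *Harmonic Analysis on Reductive p-adic Groups*, LNM 162 (1970), Part I §1, Part V §6, Part VII §3.
* [WeilBNT1967] A. Weil, *Basic Number Theory* (1967), Ch. II §5.
-/

set_option autoImplicit false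
set_option linter.dupNamespace false

noncomputable section

open MeasureTheory MeasureTheory.Measure Set Function Topology Filter
open scoped NNReal ENNReal MatrixGroups WithZero Valued
open Literature.NumberTheory.GaloisRepresentations Literature.NumberTheory.GaloisRepresentations.IsNonarchimedeanLocalField
open Literature.NumberTheory.Automorphic
open Summit.HodgeConjecture.HodgeConjecture.Cruxes.H413.K2E3HaarLocallyIntegrableTransport
open Summit.HodgeConjecture.HodgeConjecture.Cruxes.H413.K2E3GL3SupercuspidalCharLocInt
open Summit.HodgeConjecture.HodgeConjecture.Cruxes.H413.K2E3GL3ModCentre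

namespace Summit.HodgeConjecture.HodgeConjecture.Cruxes.H413.K2E3GL3ModUniformizerLocIntTransfer

/-! ## §0  Continuous factors preserve local integrability on an open set (generic; for the `‖det‖`-factors of `|D♮| = ‖disc χ‖·‖det‖⁻²`) -/

/-- **A locally integrable function on an open set times a function continuous there is locally integrable there** (on each compact `k ⊆ s` the continuous factor is
bounded; Mathlib `IntegrableOn.continuousOn_mul`). [cite: HarishChandra1970, Part V §6] -/
theorem locallyIntegrableOn_continuousOn_mul {X : Type*} [TopologicalSpace X] [MeasurableSpace X] [OpensMeasurableSpace X] [LocallyCompactSpace X] [T2Space X]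
    {R : Type*} [NormedRing R] [SecondCountableTopologyEither X R] {μ : Measure X} {s : Set X} (hs : IsOpen s) {f g : X → R}
    (hf : LocallyIntegrableOn f s μ) (hg : ContinuousOn g s) : LocallyIntegrableOn (fun x => g x * f x) s μ := by
  rw [locallyIntegrableOn_iff hs.isLocallyClosed] at hf ⊢
  exact fun k hks hk => (hf k hks hk).continuousOn_mul (hg.mono hks) hk

/-- The same with the continuous factor on the right. [cite: HarishChandra1970, Part V §6] -/
theorem locallyIntegrableOn_mul_continuousOn {X : Type*} [TopologicalSpace X] [MeasurableSpace X] [OpensMeasurableSpace X] [LocallyCompactSpace X] [T2Space X]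
    {R : Type*} [NormedRing R] [SecondCountableTopologyEither X R] {μ : Measure X} {s : Set X} (hs : IsOpen s) {f g : X → R}
    (hf : LocallyIntegrableOn f s μ) (hg : ContinuousOn g s) : LocallyIntegrableOn (fun x => f x * g x) s μ := by
  rw [locallyIntegrableOn_iff hs.isLocallyClosed] at hf ⊢
  exact fun k hks hk => (hf k hks hk).mul_continuousOn (hg.mono hks) hk

variable {F : Type*} [Field F] [Valued F ℤᵐ⁰] [ValuativeRel F] [(Valued.v : Valuation F ℤᵐ⁰).Compatible] [IsNonarchimedeanLocalField F]
variable [MeasurableSpace (GL (Fin 3) F)] [BorelSpace (GL (Fin 3) F)]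

/-- **§1 Local integrability on `G' = GL₃(F) ⧸ ϖ^ℤ·1` from local integrability of the pull-back to `GL₃(F)`** (★ (c) at `p = mk`, `V = GL₃(𝒪)`).
[cite: HarishChandra1970, Part I §1] [cite: WeilBNT1967, Ch. II §5] -/
theorem locallyIntegrable_of_locallyIntegrable_comp_mk {ϖ : F} (hϖ : Valued.v ϖ = WithZero.exp (-1 : ℤ)) (hϖ0 : ϖ ≠ 0)
    [((Subgroup.zpowers (Units.mk0 ϖ hϖ0)).map (Matrix.GeneralLinearGroup.scalar (Fin 3))).Normal]
    [MeasurableSpace (GL (Fin 3) F ⧸ (Subgroup.zpowers (Units.mk0 ϖ hϖ0)).map (Matrix.GeneralLinearGroup.scalar (Fin 3)))]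
    [BorelSpace (GL (Fin 3) F ⧸ (Subgroup.zpowers (Units.mk0 ϖ hϖ0)).map (Matrix.GeneralLinearGroup.scalar (Fin 3)))]
    (ρ : Measure (GL (Fin 3) F)) [ρ.IsHaarMeasure]
    (μ' : Measure (GL (Fin 3) F ⧸ (Subgroup.zpowers (Units.mk0 ϖ hϖ0)).map (Matrix.GeneralLinearGroup.scalar (Fin 3)))) [μ'.IsHaarMeasure]
    {E : Type*} [NormedAddCommGroup E] {W : GL (Fin 3) F ⧸ (Subgroup.zpowers (Units.mk0 ϖ hϖ0)).map (Matrix.GeneralLinearGroup.scalar (Fin 3)) → E}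
    (hWm : AEStronglyMeasurable W μ')
    (hW : LocallyIntegrable (fun g : GL (Fin 3) F => W (QuotientGroup.mk g)) ρ) :
    LocallyIntegrable W μ' := by
  haveI : IsTopologicalRing F := inferInstance
  haveI : T2Space F := (isLocalField F).toT2Space
  haveI : SecondCountableTopology (GL (Fin 3) F) := secondCountableTopology_gl3 F
  haveI : LocallyCompactSpace (GL (Fin 3) F) := locallyCompactSpace_gl3 F
  exact locallyIntegrable_of_locallyIntegrable_comp
    (QuotientGroup.mk' ((Subgroup.zpowers (Units.mk0 ϖ hϖ0)).map (Matrix.GeneralLinearGroup.scalar (Fin 3))))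
    QuotientGroup.continuous_mk QuotientGroup.isOpenMap_coe QuotientGroup.mk_surjective (glInt 3 F) (isOpen_glInt 3 F)
    (fun x hx h1 => eq_one_of_mem_glInt_of_mk_eq_one hϖ hϖ0 hx h1) ρ μ' hWm hW

variable [MeasurableSpace (Matrix (Fin 3) (Fin 3) F)] [BorelSpace (Matrix (Fin 3) (Fin 3) F)]

/-- **§2 THE T15 TRANSFER AS THE ASM EATS IT**: `W : G' → E` a.e.-strongly measurable (`μ'` Haar on `G'`), `W ∘ mk` a.e.-strongly measurable (`ρ` Haar on `GL₃(F)`),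
and `‖W (mk g)‖ ≤ w(↑g)` for every `g ∈ GL₃(F)` with `w` locally `dX`-integrable on `{X ∈ M₃(F) | IsUnit X}` ⟹ `W` is locally `μ'`-integrable
(★ (b) then ★ (c)). [cite: HarishChandra1970, Part V §6 Thm. 15, Part VII §3] [cite: WeilBNT1967, Ch. I §4, Ch. II §5] -/
theorem locallyIntegrable_of_norm_comp_mk_le {ϖ : F} (hϖ : Valued.v ϖ = WithZero.exp (-1 : ℤ)) (hϖ0 : ϖ ≠ 0)
    [((Subgroup.zpowers (Units.mk0 ϖ hϖ0)).map (Matrix.GeneralLinearGroup.scalar (Fin 3))).Normal]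
    [MeasurableSpace (GL (Fin 3) F ⧸ (Subgroup.zpowers (Units.mk0 ϖ hϖ0)).map (Matrix.GeneralLinearGroup.scalar (Fin 3)))]
    [BorelSpace (GL (Fin 3) F ⧸ (Subgroup.zpowers (Units.mk0 ϖ hϖ0)).map (Matrix.GeneralLinearGroup.scalar (Fin 3)))]
    (dX : Measure (Matrix (Fin 3) (Fin 3) F)) [dX.IsAddHaarMeasure] (ρ : Measure (GL (Fin 3) F)) [ρ.IsHaarMeasure]
    (μ' : Measure (GL (Fin 3) F ⧸ (Subgroup.zpowers (Units.mk0 ϖ hϖ0)).map (Matrix.GeneralLinearGroup.scalar (Fin 3)))) [μ'.IsHaarMeasure]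
    {w : Matrix (Fin 3) (Fin 3) F → ℝ} (hw : LocallyIntegrableOn w {X : Matrix (Fin 3) (Fin 3) F | IsUnit X} dX)
    {E : Type*} [NormedAddCommGroup E] {W : GL (Fin 3) F ⧸ (Subgroup.zpowers (Units.mk0 ϖ hϖ0)).map (Matrix.GeneralLinearGroup.scalar (Fin 3)) → E}
    (hWm : AEStronglyMeasurable W μ') (hWm' : AEStronglyMeasurable (fun g : GL (Fin 3) F => W (QuotientGroup.mk g)) ρ)
    (hle : ∀ g : GL (Fin 3) F, ‖W (QuotientGroup.mk g)‖ ≤ w (g : Matrix (Fin 3) (Fin 3) F)) :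
    LocallyIntegrable W μ' := by
  have hwgl : LocallyIntegrable (fun g : GL (Fin 3) F => w (g : Matrix (Fin 3) (Fin 3) F)) ρ := locallyIntegrable_comp_coe dX ρ hw
  have hcomp : LocallyIntegrable (fun g : GL (Fin 3) F => W (QuotientGroup.mk g)) ρ :=
    hwgl.mono hWm' (Eventually.of_forall fun g => (hle g).trans (Real.le_norm_self _))
  exact locallyIntegrable_of_locallyIntegrable_comp_mk hϖ hϖ0 ρ μ' hWm hcomp

end Summit.HodgeConjecture.HodgeConjecture.Cruxes.H413.K2E3GL3ModUniformizerLocIntTransfer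

end
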